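import Literature.NumberTheory.EllipticCurves.OrdinaryReductionTateModuleProofs
import Literature.NumberTheory.EllipticCurves.IwasawaSelmerSupersingularLocalProofs
import HarnessLib

/-!
# `E₁(K̄_v)` is `p`-divisible at a place `v ∣ p` of good ordinary reduction (Greenberg, LNM 1716, §1 p. 62; theorems only)

`Proofs` file (THEOREMS ONLY: no definition, no named fact, no instance, no `sorry`) in topic `NumberTheory/EllipticCurves`.
For an elliptic curve `E/K` over a number field, a prime `p` and a finite place `v ∣ p` of GOOD ORDINARY reduction
(`W.HasGoodReductionAt v`, `p ∤ a_v = W.frobeniusTraceAt v`), the kernel of reduction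
`E₁(K̄_v) = W.localKernelOfReduction v ≤ E(K̄_v) = localPoints W K_v` (`IwasawaSelmerSupersingularLocalProofs`; Greenberg's
`𝓕(𝔪̄)`, the points of the formal group over the maximal ideal of `\bar 𝓞_v`) is `p`-divisible, hence `p^k`-divisible:

* `WeierstrassCurve.exists_pow_nsmul_eq_of_mem_localKernelOfReduction_of_ordinary` — `∀ D ∈ E₁(K̄_v), ∃ Z ∈ E₁(K̄_v),
  p^k Z = D`.

This is the tree's `exists_nsmul_eq_of_goodReductionHom_eq_zero` (`OrdinaryReductionKernelTorsionProofs`, §5: on a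
Weierstrass equation with unit discriminant over a valuation ring `𝒪` of the algebraically closed `K̄_v`, under the ordinary
hypothesis «some `p`-torsion point has non-zero reduction», `E₁` is `p`-divisible — divide in `E(K̄_v)` and correct by a
`p`-torsion point with the same reduction, using `red(E[p]) = Ẽ[p]`), transported to the tree's `localPoints` /
`localKernelOfReduction` along the recipe of `ellipticOrdinaryReduction_tateModule_filtration_holds` (the model
`M ⊗ 𝒪` of the minimal model over `𝒪 = \bar 𝓞_v`, the valuation ring of the spectral valuation; the ordinary point from
`p ∤ a_v` via `natDegree_ΨSq_ne_zero_of_not_dvd_trace` and `exists_zsmul_eq_zero_goodReductionHom_ne_zero`); membership in the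
kernel of reduction is read off the `x`-coordinate on either model (`|x|_v > 1`). It is the input (div₁) of
`exists_torsion_sub_coboundary_mem_localKernelOfReduction` (`LocalPointsOrdinaryKummerCongruenceProofs`).

References: R. Greenberg, *Iwasawa theory for elliptic curves*, LNM 1716 (1999), §1 p. 62, §2 Props. 2.2, 2.4; J. H. Silverman,
*AEC* (2009), V.3.1, VII.2.1–2.2, VII.3.1; J.-P. Serre, Invent. Math. 15 (1972), §1.11. No summit statement is proved here;
BSD is not proved by any of this.
-/

noncomputable section

open scoped Classical NNReal
open NumberField IsDedekindDomain Polynomial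

universe u

namespace WeierstrassCurve

open Literature.NumberTheory.EllipticCurves Literature.NumberTheory.GaloisRepresentations Field
  IsDedekindDomain.HeightOneSpectrum

variable {K : Type u} [Field K] [NumberField K] (W : WeierstrassCurve K) {v : HeightOneSpectrum (𝓞 K)}


/-- **`E₁(K̄_v)` is `p^k`-divisible at a place `v ∣ p` of good ordinary reduction**: every `D ∈ E₁(K̄_v) =
W.localKernelOfReduction v` is `p^k • Z` for some `Z ∈ E₁(K̄_v)`. (Greenberg, LNM 1716, §1 p. 62: at an ordinary prime
`0 → 𝓕[p^∞] → E[p^∞] → Ẽ[p^∞] → 0` and `𝓕(𝔪̄)` is divisible; the tree's `exists_nsmul_eq_of_goodReductionHom_eq_zero` on the model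
over the valuation ring of `K̄_v`, transported to `localPoints`.) [cite: GreenbergLNM1716, §1 p. 62 and §2 Prop. 2.2]
[cite: SilvermanAEC2009, Thm. V.3.1 and Props. VII.2.1–2.2] -/
theorem exists_pow_nsmul_eq_of_mem_localKernelOfReduction_of_ordinary [W.IsElliptic] {p : ℕ} [hp : Fact p.Prime]
    (hpv : (p : 𝓞 K) ∈ v.asIdeal) (hgood : W.HasGoodReductionAt v) (hord : ¬ ((p : ℤ) ∣ W.frobeniusTraceAt v))
    (k : ℕ) {D : localPoints W (v.adicCompletion K)} (hD : D ∈ W.localKernelOfReduction v) :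
    ∃ Z ∈ W.localKernelOfReduction v, p ^ k • Z = D := by
  haveI : CharZero (v.adicCompletion K) :=
    charZero_of_injective_algebraMap (algebraMap K (v.adicCompletion K)).injective
  haveI : CharZero (AlgebraicClosure (v.adicCompletion K)) :=
    charZero_of_injective_algebraMap
      (algebraMap (v.adicCompletion K) (AlgebraicClosure (v.adicCompletion K))).injective
  have hw := coe_spectralValuation v
  set O : ValuationSubring (AlgebraicClosure (v.adicCompletion K)) := (v.spectralValuation).valuationSubring with hOdef
  have hvO : (v.spectralValuation).Integers O := Valuation.valuationSubring.integers _
  -- the minimal model `M / 𝓞_v` and its transport `MO` to `𝒪 = \bar 𝓞_v`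
  set M : WeierstrassCurve (v.adicCompletionIntegers K) := W.localMinimalIntegralModel v with hMdef
  haveI hgood' : (W.localMinimalModel v).HasGoodReduction (v.adicCompletionIntegers K) := hgood
  have hΔ : IsUnit M.Δ := by
    have hell := (hasGoodReduction_iff_isElliptic_reduction (R := v.adicCompletionIntegers K)
      (W := W.localMinimalModel v)).mp hgood
    have hu := hell.isUnit
    rw [reduction, map_Δ] at hu
    exact (_root_.isUnit_map_iff (IsLocalRing.residue _) _).mp hu
  have hEv : W.reductionAt v = M.map (IsLocalRing.residue (v.adicCompletionIntegers K)) := rfl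
  let φ : v.adicCompletionIntegers K →+* O :=
    ((algebraMap (v.adicCompletion K) (AlgebraicClosure (v.adicCompletion K))).comp
      (algebraMap (v.adicCompletionIntegers K) (v.adicCompletion K))).codRestrict O fun a ↦
      (Valuation.mem_valuationSubring_iff (v.spectralValuation) _).mpr
        ((spectralValuation_algebraMap_le_one_iff hw _).mpr a.2)
  set MO : WeierstrassCurve O := M.map φ with hMOdef
  have hΔO : IsUnit MO.Δ := by rw [hMOdef, map_Δ]; exact hΔ.map φ
  set X : WeierstrassCurve (v.adicCompletion K) :=
    M.map (algebraMap (v.adicCompletionIntegers K) (v.adicCompletion K)) with hXdef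
  have hX : X.baseChange (AlgebraicClosure (v.adicCompletion K)) =
      MO.baseChange (AlgebraicClosure (v.adicCompletion K)) := by
    rw [hXdef, hMOdef, baseChange, baseChange, WeierstrassCurve.map_map, WeierstrassCurve.map_map]
    rfl
  -- residue characteristic `p`
  have hpO : v.spectralValuation ((p : ℕ) : AlgebraicClosure (v.adicCompletion K)) < 1 := by
    have h := spectralValuation_algebraMap_ringOfIntegers_lt_one (v := v) hw hpv
    rwa [map_natCast] at h
  haveI hchar : CharP (IsLocalRing.ResidueField O) p := by
    refine (CharP.charP_iff_prime_eq_zero hp.out).mpr ?_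
    rw [← map_natCast (IsLocalRing.residue O), IsLocalRing.residue_eq_zero_iff,
      IsLocalRing.mem_maximalIdeal, mem_nonunits_iff, hvO.isUnit_iff_valuation_eq_one]
    exact fun h ↦ absurd h (ne_of_lt (by simpa using hpO))
  haveI hcharv : CharP (IsLocalRing.ResidueField (v.adicCompletionIntegers K)) p := by
    refine (CharP.charP_iff_prime_eq_zero hp.out).mpr ?_
    have h := (residue_algebraMap_eq_zero_iff K v (p : 𝓞 K)).mpr hpv
    rwa [map_natCast, map_natCast] at h
  -- the ordinary point of `MO(K̄_v)`
  haveI := isElliptic_reductionAt hgood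
  have hdegE : ((W.reductionAt v).ΨSq p).natDegree ≠ 0 :=
    natDegree_ΨSq_ne_zero_of_not_dvd_trace (W.reductionAt v) p (by rwa [frobeniusTraceAt_def] at hord)
  have hdegMO : ((MO.ΨSq p).map (IsLocalRing.residue O)).natDegree ≠ 0 := by
    rw [hMOdef, WeierstrassCurve.map_ΨSq]
    refine natDegree_map_map_residue_ne_zero φ _ ?_
    rwa [hEv, WeierstrassCurve.map_ΨSq] at hdegE
  have hordMO := exists_zsmul_eq_zero_goodReductionHom_ne_zero O hvO hΔO p hdegMO
  -- the transport `Ψ : E(K̄_v) ≃ MO(K̄_v)` and the kernel of reduction on both sides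
  let Ψ : localPoints W (v.adicCompletion K) ≃+ (MO.baseChange (AlgebraicClosure (v.adicCompletion K))).toAffine.Point :=
    (W.localPointsEquivModel v).trans (Affine.Point.congrEquiv hX)
  have hΨ : ∀ Q, Ψ Q = Affine.Point.congrEquiv hX (W.localPointsEquivModel v Q) := fun _ ↦ rfl
  have hkerΨ : ∀ Q : localPoints W (v.adicCompletion K),
      goodReductionHom MO hvO hΔO (Ψ Q) = 0 ↔ Q ∈ W.localKernelOfReduction v := by
    intro Q
    rw [goodReductionHom_eq_zero_iff, hΨ]
    rcases hQ : W.localPointsEquivModel v Q with _ | ⟨x, y, h⟩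
    · rw [← Affine.Point.zero_def, map_zero]
      exact iff_of_true WeierstrassCurve.reducesToZero_zero (W.mem_localKernelOfReduction_of_eq_zero v hQ)
    · rw [Affine.Point.congrEquiv_some, WeierstrassCurve.reducesToZero_some_iff, not_mem_range_iff hvO,
        W.mem_localKernelOfReduction_iff_of_eq_some v hQ]
  -- divide once, then iterate
  have hstep : ∀ D ∈ W.localKernelOfReduction v, ∃ Z ∈ W.localKernelOfReduction v, p • Z = D := by
    intro D hD
    obtain ⟨R, hR0, hR⟩ := exists_nsmul_eq_of_goodReductionHom_eq_zero O hvO hΔO hordMO (Ψ D) ((hkerΨ D).mpr hD)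
    refine ⟨Ψ.symm R, (hkerΨ _).mp (by rwa [AddEquiv.apply_symm_apply]), Ψ.injective ?_⟩
    rw [map_nsmul, AddEquiv.apply_symm_apply, hR]
  induction k generalizing D with
  | zero => exact ⟨D, hD, by rw [pow_zero, one_smul]⟩
  | succ k ih =>
    obtain ⟨Z₁, hZ₁, rfl⟩ := hstep D hD
    obtain ⟨Z, hZ, rfl⟩ := ih hZ₁
    exact ⟨Z, hZ, by rw [pow_succ, mul_comm, mul_smul]⟩

end WeierstrassCurve

end
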